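import Mathlib
import Summits.Schanuel.Schanuel.Theses.RigidCore
import Summits.Schanuel.Schanuel.Theorems.RoyCriterionRankOne
import Summits.Schanuel.Schanuel.Theorems.AclSubsetLogFreeCore.Negative.LogFreeCoreObjects
import Literature.NumberTheory.Transcendental.LindemannWeierstrassProofs
import Literature.NumberTheory.Transcendental.KirbyWeakSchanuelAx
import Literature.NumberTheory.Transcendental.SchanuelEclEmptyProofs
import Literature.Barriers.Schanuel.LargeTranscendenceDegree

/-!
# Crux `MinimalCounterexampleInAcl` (stmt-Schanuel-0969) — first failures lie in `ecl(∅)`, defect exactly one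

Negative-knowledge / support library for the crux (S*) `RigidCore.MinimalCounterexampleInAcl`
(a FIRST-FAILURE counterexample `x ∈ ℂⁿ` to Schanuel — `x` ℚ-linearly independent,
`trdeg ℚ(x, eˣ) < n`, `SchanuelRank r` for all `r < n` — has all coordinates in `acl^{ℂ_exp}(∅)`),
landed by the crux disprover (`--supports`) so that provers, planners and line skeletons can import
it instead of re-deriving it.  Everything is PROVED (no named facts):

* `firstFailure_two_le` — a first failure has rank `n ≥ 2` (ranks 0, 1 are theorems:
  Hermite–Lindemann, `transcendental_exp_holds`);
* `firstFailure_trdeg_eq` — TIGHTNESS: at a first failure the defect is EXACTLY one,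
  `trdeg ℚ(x, eˣ) = n − 1` (`pred_le_trdeg_of_ranks_below`: `SchanuelRank (n−1)` on a sub-tuple);
* `firstFailure_mem_ecl` — **Kirby 2010, Prop. 7.2 in first-failure form**: every coordinate of a
  first failure lies in the exponential-algebraic closure `ecl ∅` (from the tree's PROVED relative
  Schanuel theorem over `ecl ∅`, `kirby_relative_schanuel_complex_holds` = Ax's theorem, by Kirby's
  `W = ⟨x⟩ ∩ ecl ∅` / complement argument as architected in `SchanuelEclEmptyProofs`, with the ranks
  below `n` in place of Schanuel on `ecl ∅`);
* `minimalCounterexampleInAcl_iff_eclVersion`, `minimalCounterexampleInAcl_of_ecl_subset_expAcl` — so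
  the crux is EQUIVALENT to its restriction to first failures inside `(ecl ∅)ⁿ`, and FOLLOWS from the
  purely model-theoretic inclusion `ecl ∅ ⊆ acl^{ℂ_exp}(∅)`: its open content is exactly
  "exponentially algebraic ⟹ first-order algebraic" for first-failure tuples (definable isolation).

## References

* J. Kirby, *Exponential algebraicity in exponential fields*, Bull. Lond. Math. Soc. 42 (2010)
  879–890, arXiv:0810.4285: Thm. 1.2, Prop. 7.2 (p. 11), §1 (p. 2).
* J. Ax, *On Schanuel's conjectures*, Ann. of Math. 93 (1971) 252–268, Thm. 3.
-/

noncomputable section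

set_option linter.dupNamespace false

open Complex Set
open Literature.NumberTheory.Transcendental
open Summit.Schanuel.Schanuel.Theorems.AclSubsetLogFreeCore.Negative (expAcl)

namespace Summit.Schanuel.Schanuel.Theorems.MinimalCounterexampleInAcl.Negative

/-! ### Small ranks -/

/-- `SchanuelRank 1` holds (Hermite–Lindemann, tree `transcendental_exp_holds`). [folklore] -/
theorem schanuelRank_one' : SchanuelRank 1 :=
  Literature.Transcend.schanuelRank_one_of_transcendental_exp transcendental_exp_holds

/-- A first failure has rank `n ≥ 2`: at rank 0 `trdeg < 0` is impossible, rank 1 is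
Hermite–Lindemann. [folklore] -/
theorem firstFailure_two_le {n : ℕ} {x : Fin n → ℂ} (hli : LinearIndependent ℚ x)
    (htr : Algebra.trdeg ℚ ↥(IntermediateField.adjoin ℚ (range x ∪ range (cexp ∘ x))) < (n : Cardinal)) :
    2 ≤ n := by
  rcases Nat.lt_or_ge n 2 with h | h
  · interval_cases n
    · simp at htr
    · exact ((not_le.2 htr) (schanuelRank_one' x hli)).elim
  · exact h

/-! ### Tightness: the defect at a first failure is exactly one -/

/-- `trdeg ℚ(S) ≤ trdeg ℚ(T)` for `S ⊆ T`. [folklore] -/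
theorem trdeg_adjoin_mono {S T : Set ℂ} (h : S ⊆ T) :
    Algebra.trdeg ℚ ↥(IntermediateField.adjoin ℚ S) ≤ Algebra.trdeg ℚ ↥(IntermediateField.adjoin ℚ T) :=
  Literature.Barriers.Schanuel.trdeg_mono (IntermediateField.adjoin.mono ℚ _ _ h)

/-- Restricting a tuple along a map keeps `range x ∪ range (exp ∘ x)` inside the original. [folklore] -/
theorem range_union_subset_of_comp {n m : ℕ} (x : Fin n → ℂ) (e : Fin m → Fin n) :
    range (x ∘ e) ∪ range (cexp ∘ (x ∘ e)) ⊆ range x ∪ range (cexp ∘ x) := by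
  rintro a (⟨i, rfl⟩ | ⟨i, rfl⟩)
  · exact Or.inl ⟨e i, rfl⟩
  · exact Or.inr ⟨e i, rfl⟩

/-- LOWER BOUND from the ranks below: an LI `n`-tuple with `SchanuelRank r` for all `r < n` has
`trdeg ℚ(x, eˣ) ≥ n − 1` (`SchanuelRank (n-1)` on the first `n − 1` coordinates). [folklore] -/
theorem pred_le_trdeg_of_ranks_below {n : ℕ} {x : Fin n → ℂ} (hli : LinearIndependent ℚ x)
    (hrank : ∀ r < n, SchanuelRank r) :
    ((n - 1 : ℕ) : Cardinal) ≤
      Algebra.trdeg ℚ ↥(IntermediateField.adjoin ℚ (range x ∪ range (cexp ∘ x))) := by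
  rcases Nat.eq_zero_or_pos n with rfl | hn
  · simp
  · have hr : SchanuelRank (n - 1) := hrank _ (Nat.sub_lt hn one_pos)
    let e : Fin (n - 1) → Fin n := Fin.castLE (Nat.sub_le n 1)
    have hli' : LinearIndependent ℚ (x ∘ e) := hli.comp e (Fin.castLE_injective _)
    exact (hr (x ∘ e) hli').trans (trdeg_adjoin_mono (range_union_subset_of_comp x e))

/-- **TIGHTNESS**: at a first failure the transcendence degree is EXACTLY `n − 1` (defect one).
[cite: Kirby2010, §1 (essential counterexamples)] -/
theorem firstFailure_trdeg_eq {n : ℕ} {x : Fin n → ℂ} (hli : LinearIndependent ℚ x)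
    (htr : Algebra.trdeg ℚ ↥(IntermediateField.adjoin ℚ (range x ∪ range (cexp ∘ x))) < (n : Cardinal))
    (hrank : ∀ r < n, SchanuelRank r) :
    Algebra.trdeg ℚ ↥(IntermediateField.adjoin ℚ (range x ∪ range (cexp ∘ x))) = ((n - 1 : ℕ) : Cardinal) := by
  refine le_antisymm ?_ (pred_le_trdeg_of_ranks_below hli hrank)
  have h2 := firstFailure_two_le hli htr
  obtain ⟨m, rfl⟩ : ∃ m, n = m + 1 := ⟨n - 1, by omega⟩
  simp only [Nat.add_sub_cancel]
  obtain ⟨k, hk⟩ := Cardinal.lt_aleph0.1 (htr.trans Cardinal.natCast_lt_aleph0)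
  rw [hk] at htr ⊢
  have hkm : k < m + 1 := by exact_mod_cast htr
  exact_mod_cast Nat.lt_succ_iff.1 hkm

/-! ### Kirby's Prop. 7.2 in first-failure form -/

open Submodule IntermediateField in
/-- **First failures lie in `ecl(∅)`** (Kirby 2010, Prop. 7.2, first-failure form): if `x ∈ ℂⁿ` is
ℚ-linearly independent with `trdeg ℚ(x, eˣ) < n` and Schanuel holds in all ranks `< n`, then every
`x i ∈ ecl ∅`.  With `E = ecl ∅`, `V = ⟨x⟩_ℚ`, `W = V ∩ E` (dim `k`), `U` a complement (dim `m`):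
if some `x i ∉ E` then `k < n`, so `SchanuelRank k` bounds `trdeg ℚ(ȳ, e^ȳ) ≥ k` for a
(denominator-cleared) basis `ȳ` of `W`; Kirby's relative theorem gives `m ≤ trdeg` of `(z̄, e^z̄)`
over `ℚ(E) ⊇ ℚ(ȳ, e^ȳ)` for a basis `z̄` of `U`; the tower law yields `n ≤ trdeg ℚ(x, eˣ)`,
contradiction. [cite: Kirby2010, Prop. 7.2] -/
theorem firstFailure_mem_ecl {n : ℕ} {x : Fin n → ℂ} (hx : LinearIndependent ℚ x)
    (htr : Algebra.trdeg ℚ ↥(IntermediateField.adjoin ℚ (range x ∪ range (cexp ∘ x))) < (n : Cardinal))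
    (hrank : ∀ r < n, SchanuelRank r) (i₀ : Fin n) :
    x i₀ ∈ ecl (∅ : Set ℂ) := by
  by_contra hi₀
  have hrel := kirby_relative_schanuel_complex_holds
  obtain ⟨⟨SE, hSE⟩, hexp⟩ := Kirby2010_ecl_isExpSubfield_holds ℂ ∅
  -- `E = ecl ∅` as a `ℚ`-subspace of `ℂ`
  let Eq : Submodule ℚ ℂ :=
    { carrier := ecl (∅ : Set ℂ)
      add_mem' := fun {a b} ha hb => by
        rw [← hSE] at ha hb ⊢; exact SE.add_mem ha hb
      zero_mem' := by rw [← hSE]; exact SE.zero_mem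
      smul_mem' := fun q {a} ha => by
        rw [← hSE] at ha ⊢
        rw [Rat.smul_def]
        exact SE.mul_mem (SubfieldClass.ratCast_mem SE q) ha }
  have hEq : (Eq : Set ℂ) = ecl (∅ : Set ℂ) := rfl
  have hspanE : span ℚ (ecl (∅ : Set ℂ)) = Eq := by rw [← hEq, span_eq]
  -- the `ℚ`-span `V` of `x̄`, `W = V ∩ E` and a complement `U` of `W` in `V`
  set V : Submodule ℚ ℂ := span ℚ (Set.range x) with hV
  haveI : FiniteDimensional ℚ V := FiniteDimensional.span_of_finite ℚ (Set.finite_range x)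
  set W : Submodule ℚ ℂ := V ⊓ Eq with hW
  obtain ⟨U', hU'⟩ := W.exists_isCompl
  set U : Submodule ℚ ℂ := V ⊓ U' with hU
  haveI : FiniteDimensional ℚ W := Submodule.finiteDimensional_of_le inf_le_left
  haveI : FiniteDimensional ℚ U := Submodule.finiteDimensional_of_le inf_le_left
  have hWU_sup : W ⊔ U = V := by
    rw [hU, inf_comm, ← sup_inf_assoc_of_le U' (inf_le_left : W ≤ V), hU'.sup_eq_top, top_inf_eq]
  have hWU_disj : Disjoint W U := hU'.disjoint.mono_right inf_le_right
  have hUE_disj : Disjoint U Eq := by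
    rw [disjoint_def]
    intro a haU haE
    exact (disjoint_def.mp hWU_disj) a ⟨inf_le_left (b := U') haU, haE⟩ haU
  -- dimensions
  set k := Module.finrank ℚ W
  set m := Module.finrank ℚ U
  have hVn : Module.finrank ℚ V = n := by rw [hV, finrank_span_eq_card hx, Fintype.card_fin]
  have hn : k + m = n := by
    have h1 := Submodule.finrank_sup_add_finrank_inf_eq W U
    rw [hWU_disj.eq_bot, finrank_bot, add_zero, hWU_sup] at h1
    rw [← h1, hVn]
  -- FIRST-FAILURE INPUT: `x i₀ ∉ E` forces `W < V`, hence `k < n`, hence `SchanuelRank k`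
  have hklt : k < n := by
    have hWV : W < V := by
      refine lt_of_le_of_ne inf_le_left fun hWV => hi₀ ?_
      have hxV : x i₀ ∈ V := subset_span ⟨i₀, rfl⟩
      rw [← hWV] at hxV
      exact hxV.2
    simpa [hVn] using Submodule.finrank_lt_finrank_of_lt hWV
  have hSRk : SchanuelRank k := hrank k hklt
  -- bases
  let bW := Module.finBasis ℚ W
  let bU := Module.finBasis ℚ U
  let y : Fin k → ℂ := fun i => (bW i : ℂ)
  let z : Fin m → ℂ := fun j => (bU j : ℂ)
  have hy_mem : ∀ i, y i ∈ ecl (∅ : Set ℂ) := fun i => ((bW i).2 : (bW i : ℂ) ∈ V ⊓ Eq).2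
  have hy_V : ∀ i, y i ∈ V := fun i => ((bW i).2 : (bW i : ℂ) ∈ V ⊓ Eq).1
  have hz_U : ∀ j, z j ∈ U := fun j => (bU j).2
  have hz_V : ∀ j, z j ∈ V := fun j => inf_le_left (b := U') (hz_U j)
  have hy_li : LinearIndependent ℚ y := bW.linearIndependent.map' W.subtype W.ker_subtype
  have hz_li : LinearIndependent ℚ z := bU.linearIndependent.map' U.subtype U.ker_subtype
  -- clearing denominators
  choose Ny hNy hNy_mem using fun i => exists_nsmul_mem_span_int x (hy_V i)
  choose Nz hNz hNz_mem using fun j => exists_nsmul_mem_span_int x (hz_V j)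
  let cy : Fin k → ℚˣ := fun i => Units.mk0 (Ny i : ℚ) (Nat.cast_ne_zero.mpr (hNy i))
  let cz : Fin m → ℚˣ := fun j => Units.mk0 (Nz j : ℚ) (Nat.cast_ne_zero.mpr (hNz j))
  let y' : Fin k → ℂ := fun i => (Ny i : ℚ) • y i
  let z' : Fin m → ℂ := fun j => (Nz j : ℚ) • z j
  have hy'_eq : cy • y = y' := by
    funext i; simp only [Pi.smul_apply', cy, y', Units.smul_def, Units.val_mk0]
  have hz'_eq : cz • z = z' := by
    funext j; simp only [Pi.smul_apply', cz, z', Units.smul_def, Units.val_mk0]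
  have hy'_li : LinearIndependent ℚ y' := hy'_eq ▸ hy_li.units_smul cy
  have hz'_li : LinearIndependent ℚ z' := hz'_eq ▸ hz_li.units_smul cz
  have hy'_mem : ∀ i, y' i ∈ ecl (∅ : Set ℂ) := fun i => Eq.smul_mem _ (hy_mem i)
  have hz'_U : ∀ j, z' j ∈ U := fun j => U.smul_mem _ (hz_U j)
  have hz'_modE : LinearIndependent ℚ ((span ℚ (ecl (∅ : Set ℂ))).mkQ ∘ z') := by
    refine hz'_li.map ?_
    rw [ker_mkQ, hspanE]
    exact hUE_disj.mono_left (span_le.mpr (Set.range_subset_iff.mpr hz'_U))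
  -- the field-theoretic estimate
  set Sy := Set.range y' ∪ Set.range (Complex.exp ∘ y') with hSy
  set Sz := Set.range z' ∪ Set.range (Complex.exp ∘ z') with hSz
  set Ky := adjoin ℚ Sy with hKy
  set L := adjoin ℚ (ecl (∅ : Set ℂ)) with hL
  have hk : (k : Cardinal) ≤ Algebra.trdeg ℚ Ky := hSRk y' hy'_li
  have hm₀ : (m : Cardinal) ≤ Algebra.trdeg L (adjoin L Sz) := hrel m z' hz'_modE
  have hKyL : Ky ≤ L := by
    rw [hKy, adjoin_le_iff]
    rintro a (⟨i, rfl⟩ | ⟨i, rfl⟩)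
    · exact subset_adjoin ℚ _ (hy'_mem i)
    · exact subset_adjoin ℚ _ (hexp _ (hy'_mem i))
  have hm : (m : Cardinal) ≤ Algebra.trdeg Ky (adjoin Ky Sz) :=
    hm₀.trans (trdeg_adjoin_le_of_le hKyL Sz)
  have hkm : (k : Cardinal) + m ≤ Algebra.trdeg ℚ (adjoin ℚ (Sy ∪ Sz)) :=
    add_le_trdeg_adjoin_union Sy Sz hk hm
  -- comparison with `ℚ(x̄, e^{x̄})`
  set Kx := adjoin ℚ (Set.range x ∪ Set.range (Complex.exp ∘ x)) with hKx
  have hle : adjoin ℚ (Sy ∪ Sz) ≤ Kx := by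
    rw [adjoin_le_iff]
    rintro a ((⟨i, rfl⟩ | ⟨i, rfl⟩) | (⟨j, rfl⟩ | ⟨j, rfl⟩))
    · exact (mem_adjoin_of_mem_span_int x (hNy_mem i)).1
    · exact (mem_adjoin_of_mem_span_int x (hNy_mem i)).2
    · exact (mem_adjoin_of_mem_span_int x (hNz_mem j)).1
    · exact (mem_adjoin_of_mem_span_int x (hNz_mem j)).2
  have hfin : Algebra.trdeg ℚ (adjoin ℚ (Sy ∪ Sz)) ≤ Algebra.trdeg ℚ Kx :=
    trdeg_le_of_injective (IntermediateField.inclusion hle) (IntermediateField.inclusion_injective hle)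
  have hnle : (n : Cardinal) ≤ Algebra.trdeg ℚ Kx :=
    calc (n : Cardinal) = (k : Cardinal) + m := by rw [← hn, Nat.cast_add]
      _ ≤ Algebra.trdeg ℚ (adjoin ℚ (Sy ∪ Sz)) := hkm
      _ ≤ Algebra.trdeg ℚ Kx := hfin
  exact (not_le.2 htr) hnle

/-- Hence the crux is EQUIVALENT to its restriction to first failures inside `(ecl ∅)ⁿ`.
[cite: Kirby2010, Prop. 7.2] -/
theorem minimalCounterexampleInAcl_iff_eclVersion :
    Summit.Schanuel.Schanuel.Theses.RigidCore.MinimalCounterexampleInAcl ↔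
      ∀ (n : ℕ) (x : Fin n → ℂ), LinearIndependent ℚ x →
        Algebra.trdeg ℚ ↥(IntermediateField.adjoin ℚ (range x ∪ range (cexp ∘ x))) < (n : Cardinal) →
        (∀ r < n, SchanuelRank r) → (∀ i, x i ∈ ecl (∅ : Set ℂ)) →
        ∀ i, ∃ s : Set ℂ, s.Finite ∧
          Set.Definable₁ (∅ : Set ℂ) Literature.ModelTheory.ExponentialFields.Language.expRing s ∧ x i ∈ s :=
  ⟨fun h n x hli htr hrank _ => h n x hli htr hrank,
    fun h n x hli htr hrank => h n x hli htr hrank fun i => firstFailure_mem_ecl hli htr hrank i⟩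

/-- … and FOLLOWS from the purely model-theoretic inclusion `ecl ∅ ⊆ acl^{ℂ_exp}(∅)` ("every
exponentially algebraic complex number is first-order algebraic over `∅` in `(ℂ,+,·,exp)`"), with no
transcendence input at all. (That inclusion is open and is expected to FAIL under Zilber's
conjecture — e.g. at transcendental fixed points of `exp`, which are all conjugate in `𝔹`; the crux
only needs it at first-failure tuples.) [folklore] -/
theorem minimalCounterexampleInAcl_of_ecl_subset_expAcl (h : ecl (∅ : Set ℂ) ⊆ expAcl) :
    Summit.Schanuel.Schanuel.Theses.RigidCore.MinimalCounterexampleInAcl :=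
  minimalCounterexampleInAcl_iff_eclVersion.2 fun _ _ _ _ _ hmem i => h (hmem i)

end Summit.Schanuel.Schanuel.Theorems.MinimalCounterexampleInAcl.Negative

end
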